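import Summits.QuantumFields.YangMills.Theorems.UnitScaleTiltProp7OneFormGreenBlockColumnOfLiftAbs
import Summits.QuantumFields.YangMills.Theorems.UnitScaleTiltProp7OneFormGreenKFreeNumerics
import HarnessLib

/-!
# Route `UnitScaleTilt`, crux K1 «MinimiserStabilityRegPr» (stmt-QuantumFields-19200), (K2)-storey, pen D2 (member level):
# **THE BLOCK-`L¹` COLUMN OF `G₀` WITH A K-FREE CONSTANT** — (K2-L1) under `Lift` at the coupling window `a ≤ a₁(c₀∕cB)ℓ³` and `hk_D = C_K·ℓ⁻³`, the numerics discharged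

Cell `ym3-torus` (HUMAN RULING D-0037; rung R3 = SU(2) YM₃ on T³ — NOT d = 4, NOT infinite volume, NOT a mass gap, NOT Clay).  Width seat `ym3-torus-px16` g13
(`--supports stmt-QuantumFields-19200 --as helper`).  THEOREMS ONLY (0 `def`, 0 `sorry`, default heartbeats); count-neutral.

WHAT.  ✓`blockColumn_GT_DeltaEtaSlot_of_lift_abs` displays `0 < Θ` (with the member's `θ_V`) and concludes with the member's `2A₂`.  Here the coupling is taken in the window
`0 ≤ a ≤ a₁·(c₀∕cB)·ℓ³` (print's `a` at the averaging normalisation), `hk_D` in px10's ✓`kernelRow349_allMembers_exists` currency `C_K·ℓ⁻³·e^{−δ_K·blockdist}`, and `(r, ε)` under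
FOUR EXPLICIT MEMBER-FREE BUDGETS (`ε ≤ ⅛`, `ε·C_V¹ ≤ γ∕8`, `r ≤ γε∕48`, `r·T(a₁, C_K, δ_K) ≤ γ∕16`) plus the cap `10⁵ε₀ ≤ γ∕16`; THEN `Θ ≥ γ∕2` (✓`theta_ge_half_of_budgets` +
✓`thetaV_le_kfree` + ✓`rbudget_le` + ✓`CV_abs_le`), the window `S ≤ ½` (✓`hsmall_le_half`), and the conclusion constant is `≤ C_G(γ, C_K, δ_K, a₁, r)` (✓`twoA₂_le_kfree`) —
MEMBER-FREE: ★★★ `blockColumn_GT_DeltaEtaSlot_kfree`.  This is the member half of the Idx∕family edition (the family theorem only chooses `r(L), ε(L)`, the cap, and cites the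
(γ)∕hk_D packages).
HONEST SCOPE.  Re-knit + real arithmetic; CONDITIONAL on (γ) `hco`, `hk_D`, `Lift`, the budgets; nothing of `norm_G`∕`hCk`∕EX∕the crux is proved; no summit is proved by a helper.

References: T. Bałaban, CMP **99** (1985) 389–434 [Balaban1985BackgroundPropagators] (Thm 3.3 (3.46)–(3.49) pp.398–399, Thm 3.11 p.416, Thm 3.12 p.422).
-/

set_option autoImplicit false

noncomputable section

open scoped Matrix.Norms.L2Operator BigOperators InnerProductSpace ComplexConjugate

namespace Summit.QuantumFields.YangMills.Theorems.Prop7OneFormGreenBlockColumnKFree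

open Literature.MathematicalPhysics.QuantumFieldTheory.Balaban1983to89
open Literature.MathematicalPhysics.QuantumFieldTheory.Balaban1983to89.T3ContinuumYM3Torus
open Literature.MathematicalPhysics.QuantumFieldTheory.Balaban1983to89.T3PrintedRegularMinimiser (RegPr)
open B15DeterminingSets (embIter)
open T3SectALandauChart (formComp bgUnits eta eta_pos)
open B9SectCLatticeCarrier (Bond)
open B9Eq311L2Pairing (WL2)
open B11Eq103H1Complex (BondL2K)
open B5Eq118OneStroke (iterBlockOf)
open Summit.QuantumFields.YangMills.Theorems.Prop8Chart (emlIterU)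
open Summit.QuantumFields.YangMills.Theorems.Prop7SectET3Transport (periodsT3 bondEquiv)
open Summit.QuantumFields.YangMills.Theorems.Prop7SectET3HilbertLetters (W₂ frobEquiv toL2 toL2S DL2 DstarL2)
open Summit.QuantumFields.YangMills.Theorems.Prop7SectET3WilsonHessian (DeltaEtaSlot)
open Summit.QuantumFields.YangMills.Theorems.Prop7SectET3GaugeProjector (RS)
open Summit.QuantumFields.YangMills.Theorems.Prop7SectET3CurvedPropagators (laplaceA Qk GT PosOnto)
open Summit.QuantumFields.YangMills.Theorems.Prop7OneFormGreenBlockColumnOfLiftAbs (blockColumn_GT_DeltaEtaSlot_of_lift_abs)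
open Summit.QuantumFields.YangMills.Theorems.Prop7OneFormGreenKFreeNumerics (thetaV_le_kfree twoA₂_le_kfree hsmall_le_half rbudget_le theta_ge_half_of_budgets CV_abs_le)

variable (F : T3Family) {n K : ℕ} (h : n ≤ K) (c₀ cB : ℝ) [Fact (0 < c₀)] [Fact (0 < cB)]

/-- ★★★ **THE BLOCK-`L¹` COLUMN OF `G₀ = Δ_a(U₀)⁻¹` WITH A MEMBER-FREE CONSTANT**: at `RegPr F n K ε₀ U₀` with the windows `10¹²L³ε₀ ≤ 1`, `10¹⁰L⁶ε₀ ≤ 1`, `13·10¹⁴L³ε₀ ≤ 1`,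
under `Lift`, for a coupling `0 ≤ a ≤ a₁(c₀∕cB)ℓ³`, (γ) `hco` with `0 < γ`, `hk_D` with constant `C_K·ℓ⁻³` at rate `δ_K > 0`, and `(r, ε)` under the budgets `0 < r ≤ ¼`, `r ≤ δ_K∕2`,
`0 < ε ≤ ⅛`, `ε·C_V¹ ≤ γ∕8`, `r ≤ γε∕48`, `r·T ≤ γ∕16`, `10⁵ε₀ ≤ γ∕16`:
`∀ b Z y, Σ_{bd : B bd₋ = y} ‖toL2⁻¹(G₀(toL2 δ_bZ)) bd‖ ≤ C_G(γ, C_K, δ_K, a₁, r)·e^{−(min r ¼∕2)·tdist(y, B b₋)}·‖Z‖` with the MEMBER-FREE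
`C_G = 4·((√2 + √2·(50a₁e^{δ_K} + C_K)·3√2·e^{6r}(2∕γ)·(2(1+2∕δ_K))³)·8e^{3r}·14 + 36·√(8e^{3r}(2(1+1∕r))³)·e^{6r}(2∕γ))`.  CONDITIONAL on the displayed letters.
[cite: Balaban1985BackgroundPropagators, Thm 3.3 (3.46)–(3.49) pp.398–399, Thm 3.11 p.416, Thm 3.12 p.422] -/
theorem blockColumn_GT_DeltaEtaSlot_kfree (hnK : n < K) {ε₀ : ℝ} (hε₀ : 0 < ε₀) (hWε : 10 ^ 12 * (F.L : ℝ) ^ 3 * ε₀ ≤ 1)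
    (hε10 : 10 ^ 10 * (F.L : ℝ) ^ 6 * ε₀ ≤ 1) (hwin : 13 * 10 ^ 14 * (F.L : ℝ) ^ 3 * ε₀ ≤ 1)
    (U₀ : GaugeField (F.P K) 0 (Matrix.specialUnitaryGroup (Fin 2) ℂ)) (hreg : RegPr F n K ε₀ U₀)
    (hlift : ∀ cf : Site (F.P K) (K - n) → Matrix (Fin 2) (Fin 2) ℂ,
        (∀ e : PBond (F.P K) (K - n), cf e.src = ((emlIterU (K - n) (bgUnits F K U₀) e : (Matrix (Fin 2) (Fin 2) ℂ)ˣ) : Matrix (Fin 2) (Fin 2) ℂ) * cf e.tgt *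
          (((emlIterU (K - n) (bgUnits F K U₀) e)⁻¹ : (Matrix (Fin 2) (Fin 2) ℂ)ˣ) : Matrix (Fin 2) (Fin 2) ℂ)) →
        ∃ l₀ : Site (F.P K) 0 → Matrix (Fin 2) (Fin 2) ℂ,
          (∀ b : PBond (F.P K) 0, l₀ b.src = ((bgUnits F K U₀ b : (Matrix (Fin 2) (Fin 2) ℂ)ˣ) : Matrix (Fin 2) (Fin 2) ℂ) * l₀ b.tgt * (((bgUnits F K U₀ b)⁻¹ : (Matrix (Fin 2) (Fin 2) ℂ)ˣ) : Matrix (Fin 2) (Fin 2) ℂ)) ∧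
          ∀ y : Site (F.P K) (K - n), l₀ (embIter (K - n) y) = cf y)
    {a a₁ : ℝ} (ha : 0 ≤ a) (ha₁ : a ≤ a₁ * (c₀ / cB) * ((F.L : ℝ) ^ (K - n)) ^ 3)
    {γ : ℝ} (hγ : 0 < γ) (hco : ∀ v : BondL2K ℂ 3 (periodsT3 F K) c₀ W₂, γ * ‖v‖ ^ 2 ≤ RCLike.re ⟪v, laplaceA F n K h c₀ cB a (DeltaEtaSlot F n K c₀) U₀ v⟫_ℂ)
    {CK δK : ℝ} (hCK : 0 ≤ CK) (hδK : 0 < δK)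
    (hkD : ∀ (b : PBond (F.P K) 0) (Z : Matrix (Fin 2) (Fin 2) ℂ) (bd : PBond (F.P K) 0),
      ‖(toL2 F K c₀).symm (DL2 F n K c₀ U₀ (DstarL2 F n K c₀ U₀ (toL2 F K c₀ (Pi.single b Z))
          - RS F n K h c₀ cB U₀ (DstarL2 F n K c₀ U₀ (toL2 F K c₀ (Pi.single b Z))))) bd‖
        ≤ CK * ((F.L : ℝ) ^ (K - n))⁻¹ ^ 3 * Real.exp (-(δK * (Site.tdist (P := F.P K) (iterBlockOf (K - n) b.src) (iterBlockOf (K - n) bd.src) : ℝ))) * ‖Z‖)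
    {r ε : ℝ} (hr : 0 < r) (hr4 : r ≤ 1 / 4) (hrδ : r ≤ δK / 2) (hε : 0 < ε) (hε8 : ε ≤ 1 / 8)
    (hεC : ε * (32 * Real.sqrt 2 * 648 + (33 / 8 : ℝ) ^ 2 * (600 * (27 / 4 : ℝ) ^ 6)) ≤ γ / 8) (hrγ : r ≤ γ * ε / 48)
    (hrT : r * (5000 * a₁ + 27 * Real.sqrt 2 * CK * (2 * (1 + 4 / δK)) ^ 3 / min 1 (δK / 4)) ≤ γ / 16) (hαγ : 10 ^ 5 * ε₀ ≤ γ / 16) :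
    ∀ (b : PBond (F.P K) 0) (Z : Matrix (Fin 2) (Fin 2) ℂ) (y : Site (F.P K) (K - n)),
      ∑ bd ∈ Finset.univ.filter (fun bd : PBond (F.P K) 0 => iterBlockOf (K - n) bd.src = y),
          ‖(toL2 F K c₀).symm (GT F n K h c₀ cB a (DeltaEtaSlot F n K c₀) U₀ (toL2 F K c₀ (Pi.single b Z))) bd‖
        ≤ 4 * ((Real.sqrt 2 + Real.sqrt 2 * ((50 * a₁ * Real.exp δK + CK) * (3 * Real.sqrt 2) * (Real.exp (6 * r) * (2 / γ)) * (2 * (1 + 2 / δK)) ^ 3))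
                * (8 * Real.exp (3 * r)) * 14
              + 36 * (Real.sqrt (8 * Real.exp (3 * r) * (2 * (1 + 1 / r)) ^ 3) * (Real.exp (6 * r) * (2 / γ))))
          * Real.exp (-((min r (1 / 4) / 2) * (Site.tdist (P := F.P K) y (iterBlockOf (K - n) b.src) : ℝ))) * ‖Z‖ := by
  intro b Z y
  have hc₀ : 0 < c₀ := Fact.out
  have hcB : 0 < cB := Fact.out
  have hd : (F.P K).d = 3 := rfl
  have hL2 : (2 : ℝ) ≤ F.L := by exact_mod_cast F.hL.2
  have hLr : (1 : ℝ) ≤ F.L := le_trans one_le_two hL2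
  have hL3 : (1 : ℝ) ≤ (F.L : ℝ) ^ 3 := one_le_pow₀ hLr
  have hε5 : ε₀ ≤ (10 : ℝ)⁻¹ ^ 5 := by
    have h1 : 10 ^ 12 * ε₀ ≤ 10 ^ 12 * (F.L : ℝ) ^ 3 * ε₀ := by nlinarith [hε₀.le]
    have h2 : 10 ^ 12 * ε₀ ≤ 1 := h1.trans hWε
    rw [inv_pow]
    rw [le_inv_comm₀ hε₀ (by positivity)]
    calc (10 : ℝ) ^ 5 ≤ 10 ^ 12 := by norm_num
      _ ≤ ε₀⁻¹ := by rw [le_inv_comm₀ (by positivity) hε₀]; exact (le_div_iff₀' (by positivity)).mpr (by linarith) |>.trans (le_of_eq (one_div _))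
  have hε1 : ε₀ ≤ 1 := hε5.trans (by norm_num)
  -- the four budgets ⟹ `Θ ≥ γ∕2`
  have hθ := thetaV_le_kfree hd hLr (K - n) hc₀ hcB ha ha₁ hCK hδK hr hr4 hrδ hε₀.le
  have hθ8 := hθ.trans (show r * (5000 * a₁ + 27 * Real.sqrt 2 * CK * (2 * (1 + 4 / δK)) ^ 3 / min 1 (δK / 4)) + 10 ^ 5 * ε₀ ≤ γ / 8 by linarith)
  have hεC' := (mul_le_mul_of_nonneg_left (CV_abs_le hd hε1) hε.le).trans hεC
  have hR := (rbudget_le hγ.le hr hr4 hε (by linarith) hrγ).trans (show γ / 16 ≤ γ / 8 by linarith [hγ.le])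
  have hΘ := theta_ge_half_of_budgets hγ.le hε8 hεC' hR hθ8
  have hS := hsmall_le_half hr4 hε₀.le hε5
  have hcol := blockColumn_GT_DeltaEtaSlot_of_lift_abs F h c₀ cB hnK hε₀ hWε hε10 hwin U₀ hreg hlift ha hγ hco hr (show r < δK by linarith)
    (by positivity : 0 ≤ CK * ((F.L : ℝ) ^ (K - n))⁻¹ ^ 3) hkD hε (by linarith) (lt_of_lt_of_le (by positivity) hΘ) (lt_of_le_of_lt hS (by norm_num)) b Z y
  have hA := twoA₂_le_kfree hd hLr (K - n) hc₀ hcB ha ha₁ hCK hδK hr hr4 hrδ hγ hΘ hε₀.le hε5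
  exact hcol.trans (mul_le_mul_of_nonneg_right (mul_le_mul_of_nonneg_right hA (Real.exp_pos _).le) (norm_nonneg _))

end Summit.QuantumFields.YangMills.Theorems.Prop7OneFormGreenBlockColumnKFree

end
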